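import Mathlib
import Literature.NumberTheory.Automorphic.HilbertModularFormQExpansion
import Summits.Langlands.Langlands.Theorems.CapacityClassicalityHilbertIntegralOverconvergentIsCongruenceStubFiniteQIndexAntidiagonal
import Summits.Langlands.Langlands.Theorems.CapacityClassicalityHilbertIntegralOverconvergentIsCongruenceStubFourierCoeffMul

/-!
# Cone convolutions of tube-summable coefficient functions (stub stub_cauchy_product_tube of line Sketch-ideate-r1-k1)

Stub X6 `stub_cauchy_product_tube` of line Sketch-ideate-r1-k1 (section X, Rankin–Cohen brackets) for the crux
`HilbertIntegralOverconvergentIsCongruence` (stmt-Langlands-8485).  For non-negative coefficient functions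
`α, β : F → ℝ` on a totally real field `F` whose weighted sums `∑_{ν ∈ 𝔡⁻¹} α(ν) e^{-2π⟨ν,y⟩}` over the dual
lattice `𝔡⁻¹` converge at every height `y ≫ 0`, the cone convolution
`ν ↦ ∑_{μ + μ' = ν, μ, μ' ∈ qIndexSet F} α(μ) β(μ')` (a finite sum, `stub_finite_qIndex_antidiagonal`) has the same
property.

Proof.  Fix `y` and put `w(ν) = e^{-2π⟨ν,y⟩}`, so `w(μ + μ') = w(μ) w(μ')`.  The product family
`(μ, μ') ↦ α(μ)w(μ) · β(μ')w(μ')` on `𝔡⁻¹ × 𝔡⁻¹` is summable (`Summable.mul_of_nonneg`) and non-negative, so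
regrouping it along the fibres of the sum map `(μ, μ') ↦ μ + μ'` (`summable_partition`) gives a summable family
of fibre sums `ν ↦ ∑'_{μ + μ' = ν} α(μ)w(μ) β(μ')w(μ')`.  The cone antidiagonal of `ν` injects into the fibre of
`ν`, so the finite cone convolution times `w(ν)` is dominated by the fibre sum, and `Summable.of_nonneg_of_le`
concludes.
-/

set_option linter.dupNamespace false

noncomputable section

namespace Summit.Langlands.Langlands.Theorems.HilbertIntegralOverconvergentIsCongruence

open MeasureTheory Complex NumberField
open Literature.NumberTheory.Automorphic Literature.NumberTheory.Automorphic.HilbertModular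
open scoped MatrixGroups

/-- The tube weight `w(ν) = e^{-2π ∑_σ σ(ν) y_σ}` is multiplicative: `w(μ + μ') = w(μ) w(μ')`. [folklore] -/
theorem cpt_weight_add {F : Type} [Field F] [NumberField F] (y : (F →+* ℝ) → ℝ) (μ μ' : F) :
    Real.exp (-(2 * Real.pi * ∑ σ : F →+* ℝ, σ (μ + μ') * y σ)) =
      Real.exp (-(2 * Real.pi * ∑ σ : F →+* ℝ, σ μ * y σ)) *
        Real.exp (-(2 * Real.pi * ∑ σ : F →+* ℝ, σ μ' * y σ)) := by
  rw [← Real.exp_add]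
  congr 1
  simp only [map_add, add_mul, Finset.sum_add_distrib]
  ring

/-- Abstract form of the cone Cauchy product estimate: for non-negative `α, β` and a non-negative multiplicative
weight `w` (`w(μ + μ') = w(μ) w(μ')`) with `∑_{𝔡⁻¹} α w < ∞` and `∑_{𝔡⁻¹} β w < ∞`, the cone convolution
`ν ↦ ∑_{μ + μ' = ν} α(μ) β(μ')` (pairs of cone indices) satisfies `∑_{𝔡⁻¹} (α ⋆ β) w < ∞`: the product family
regrouped along the fibres of `(μ, μ') ↦ μ + μ'` dominates it. [folklore] -/
theorem cpt_summable_convolution {F : Type} [Field F] [NumberField F] [NumberField.IsTotallyReal F]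
    (α β w : F → ℝ) (hα0 : ∀ ν, 0 ≤ α ν) (hβ0 : ∀ ν, 0 ≤ β ν) (hw0 : ∀ ν, 0 ≤ w ν)
    (hw : ∀ μ μ', w (μ + μ') = w μ * w μ')
    (hα : Summable (fun ν : {ν : F | ∀ b : 𝓞 F, ∃ n : ℤ, Algebra.trace ℚ F (ν * b) = n} ↦ α ν * w ν))
    (hβ : Summable (fun ν : {ν : F | ∀ b : 𝓞 F, ∃ n : ℤ, Algebra.trace ℚ F (ν * b) = n} ↦ β ν * w ν)) :
    Summable (fun ν : {ν : F | ∀ b : 𝓞 F, ∃ n : ℤ, Algebra.trace ℚ F (ν * b) = n} ↦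
      (∑ μ ∈ (stub_finite_qIndex_antidiagonal F (ν : F)).toFinset, α μ.1 * β μ.2) * w ν) := by
  classical
  set D : Set F := {ν : F | ∀ b : 𝓞 F, ∃ n : ℤ, Algebra.trace ℚ F (ν * b) = n} with hDdef
  -- the sum map on pairs of dual-lattice indices
  let add : D × D → D := fun p ↦ ⟨(p.1 : F) + p.2, fcm_dual_add p.1.2 p.2.2⟩
  -- the product family on pairs of indices
  let P : F × F → ℝ := fun μ ↦ (α μ.1 * w μ.1) * (β μ.2 * w μ.2)
  have hP0 : ∀ μ, 0 ≤ P μ := fun μ ↦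
    mul_nonneg (mul_nonneg (hα0 _) (hw0 _)) (mul_nonneg (hβ0 _) (hw0 _))
  have hprod : Summable fun p : D × D ↦ P ((p.1 : F), (p.2 : F)) :=
    hα.mul_of_nonneg hβ (fun μ ↦ mul_nonneg (hα0 _) (hw0 _)) (fun μ ↦ mul_nonneg (hβ0 _) (hw0 _))
  have hpart : ∀ p : D × D, ∃! ν' : D, p ∈ {q : D × D | add q = ν'} := fun p ↦
    ⟨add p, rfl, fun ν' h ↦ h.symm⟩
  have hnonneg : (0 : D × D → ℝ) ≤ fun p ↦ P ((p.1 : F), (p.2 : F)) := fun p ↦ hP0 _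
  obtain ⟨hfib, hout⟩ := (summable_partition hnonneg hpart).1 hprod
  refine Summable.of_nonneg_of_le (fun ν ↦ ?_) (fun ν ↦ ?_) hout
  · exact mul_nonneg (Finset.sum_nonneg fun μ _ ↦ mul_nonneg (hα0 _) (hβ0 _)) (hw0 _)
  · have hT : ∀ μ : F × F, μ ∈ (stub_finite_qIndex_antidiagonal F (ν : F)).toFinset ↔
        μ.1 ∈ qIndexSet F ∧ μ.2 ∈ qIndexSet F ∧ μ.1 + μ.2 = ν := fun μ ↦
      Set.Finite.mem_toFinset _
    set T := (stub_finite_qIndex_antidiagonal F (ν : F)).toFinset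
    -- the finite cone convolution times the weight is a finite sum of values of `P`
    have hsum_eq : (∑ μ ∈ T, α μ.1 * β μ.2) * w ν = ∑ μ ∈ T, P μ := by
      rw [Finset.sum_mul]
      refine Finset.sum_congr rfl fun μ hμ ↦ ?_
      have h : w (ν : F) = w μ.1 * w μ.2 := by rw [← ((hT μ).1 hμ).2.2, hw]
      simp only [P, h]
      ring
    rw [hsum_eq]
    -- inject the cone antidiagonal `T` into the fibre of `add` over `ν`
    have hmemD : ∀ μ : F × F, μ ∈ T → μ.1 ∈ D ∧ μ.2 ∈ D := fun μ hμ ↦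
      ⟨((hT μ).1 hμ).1.1, ((hT μ).1 hμ).2.1.1⟩
    let ι : T → {q : D × D | add q = ν} := fun μ ↦
      ⟨(⟨(μ : F × F).1, (hmemD μ μ.2).1⟩, ⟨(μ : F × F).2, (hmemD μ μ.2).2⟩),
        Subtype.ext ((hT μ).1 μ.2).2.2⟩
    have hι : Function.Injective ι := by
      intro μ μ' h
      have h1 := congrArg
        (fun p : {q : D × D | add q = ν} ↦ ((((p : D × D).1 : D) : F), (((p : D × D).2 : D) : F))) h
      exact Subtype.ext (Prod.ext (congrArg Prod.fst h1) (congrArg Prod.snd h1))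
    calc ∑ μ ∈ T, P μ = ∑' μ : T, P μ := (Finset.tsum_subtype T P).symm
      _ ≤ ∑' p : {q : D × D | add q = ν}, P ((((p : D × D).1 : D) : F), (((p : D × D).2 : D) : F)) :=
        Summable.tsum_le_tsum_of_inj ι hι (fun c _ ↦ hP0 _) (fun μ ↦ le_rfl) Summable.of_finite
          (hfib ν)

/-- **stub X6 — `stub_cauchy_product_tube` (M; convolutions of tube-summable non-negative coefficient functions are tube-summable).**
If `α, β ≥ 0` on `F` have `∑_{ν ∈ 𝔡⁻¹} α(ν) e^{-2π⟨ν,y⟩} < ∞` and the same for `β` at every height `y ≫ 0`, then so does the cone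
convolution `ν ↦ ∑_{μ+μ'=ν, μ,μ' ∈ cone} α(μ) β(μ')` (sum over the fibres of `(μ,μ') ↦ μ+μ'` on cone pairs of the product of the two
absolutely convergent series, `e^{-2π⟨μ+μ',y⟩} = e^{-2π⟨μ,y⟩} e^{-2π⟨μ',y⟩}`; the fibre bookkeeping of the landed `stub_fourierCoeff_mul`). [folklore] -/
theorem stub_cauchy_product_tube (F : Type) [Field F] [NumberField F] [NumberField.IsTotallyReal F] (α β : F → ℝ)
    (hα0 : ∀ ν, 0 ≤ α ν) (hβ0 : ∀ ν, 0 ≤ β ν)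
    (hα : ∀ y : (F →+* ℝ) → ℝ, (∀ σ, 0 < y σ) →
      Summable (fun ν : {ν : F | ∀ b : 𝓞 F, ∃ n : ℤ, Algebra.trace ℚ F (ν * b) = n} ↦
        α ν * Real.exp (-(2 * Real.pi * ∑ σ : F →+* ℝ, σ (ν : F) * y σ))))
    (hβ : ∀ y : (F →+* ℝ) → ℝ, (∀ σ, 0 < y σ) →
      Summable (fun ν : {ν : F | ∀ b : 𝓞 F, ∃ n : ℤ, Algebra.trace ℚ F (ν * b) = n} ↦
        β ν * Real.exp (-(2 * Real.pi * ∑ σ : F →+* ℝ, σ (ν : F) * y σ)))) :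
    ∀ y : (F →+* ℝ) → ℝ, (∀ σ, 0 < y σ) →
      Summable (fun ν : {ν : F | ∀ b : 𝓞 F, ∃ n : ℤ, Algebra.trace ℚ F (ν * b) = n} ↦
        (∑ μ ∈ (stub_finite_qIndex_antidiagonal F (ν : F)).toFinset, α μ.1 * β μ.2) *
          Real.exp (-(2 * Real.pi * ∑ σ : F →+* ℝ, σ (ν : F) * y σ))) := by
  intro y hy
  exact cpt_summable_convolution α β (fun μ ↦ Real.exp (-(2 * Real.pi * ∑ σ : F →+* ℝ, σ μ * y σ)))
    hα0 hβ0 (fun _ ↦ (Real.exp_pos _).le) (cpt_weight_add y) (hα y hy) (hβ y hy)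

end Summit.Langlands.Langlands.Theorems.HilbertIntegralOverconvergentIsCongruence

end
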